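import Summits.AnomalousDissipation.AnomalousDissipation.Theorems.SolenoidalFractalHomogenisationRealisedQuasiStaticCellLawUpperSomeLadderTrapezoid
import Summits.AnomalousDissipation.AnomalousDissipation.Theorems.SolenoidalFractalHomogenisationRealisedQuasiStaticCellLawCellLadder
import HarnessLib

/-!
# K2R `RealisedQuasiStaticCellLaw`, line `floquet-bloch`, stub `stub_upperSome`: the first-order cone of the fast
# components of a three-term ladder (abstract), and two small slot facts

Summits-side helper file (everything proved; no definitions, no named facts; `--supports stmt-AnomalousDissipation-20446`).
* `fast_energy_pointwise` / `fast_energy_window` — for the ladder `v_J' = −Λ(d_J v_J + g(t)(s_{J−1}v_{J−1} − s_Jv_{J+1}))`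
  on a window `W ∋ ±1` with gap `d_J ≥ d₀ + Δ` off `0`, `d₀ ≥ 0`, `|g| ≤ g_T` and a bound `‖v₀‖ ≤ V` on the slow entry, the
  fast energy `Z = Σ_{J≠0}‖v_J‖²` obeys `Z(t) ≤ e^{−ΛΔ(t−t₀)} Z(t₀) + (g_Tγ V/Δ)²` (exchange identity
  `re_sum_conj_mul_link_eq_zero` on `W ∖ 0`, the two boundary links to `v₀`, AM–GM, linear Grönwall): the first-order
  slaving CONE of the fast block, uniform in `W`;
* `abs_mul_trapezoid_le`, `cellRate_pos` — `|g₁·trapezoid| ≤ |g₁|`, `0 < κ4π²|K_j|²`.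
Energy LOWER-bound half of the K2R bracket; not anomalous dissipation.
-/

set_option linter.dupNamespace false -- layout D-0017: `AnomalousDissipation.AnomalousDissipation` repeats by design

noncomputable section

namespace Summit.AnomalousDissipation.AnomalousDissipation.Theorems.SolenoidalFractalHomogenisation.RealisedQuasiStaticCellLaw

open Set MeasureTheory Filter Topology Function Complex
open scoped InnerProductSpace ComplexConjugate BigOperators
open Literature.Analysis Literature.Analysis.FunctionSpaces Literature.Analysis.FunctionSpaces.Torus
open Literature.Analysis.FluidPDE Literature.Analysis.FluidPDE.LatticeShear


/-! ## §1 The first-order cone of the fast components (abstract ladder) -/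

/-- **Pointwise fast-energy inequality.** At one instant: state `x` vanishing off `W ∋ ±1`, ladder field `Fv` with coupling
value `gt`, `|gt| ≤ g_T`, links `|s_J| ≤ 1`, gap `d_J ≥ d₀ + Δ` off `0` with `d₀ ≥ 0`, `‖x₀‖ ≤ V`. Then
`Σ_{J≠0} 2 Re(Fv_J conj x_J) ≤ −ΛΔ Σ_{J≠0}‖x_J‖² + Λ g_T² γ² V²/Δ`. -/
theorem fast_energy_pointwise (W : Finset ℤ) (h1 : (1 : ℤ) ∈ W) (hm1 : (-1 : ℤ) ∈ W)
    (d s : ℤ → ℝ) (Λ gT Δ γ V gt : ℝ) (x Fv : ℤ → ℂ)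
    (hs : ∀ J ∈ W, |s J| ≤ 1) (hγ : γ ^ 2 = s 0 ^ 2 + s (-1) ^ 2) (hγ0 : 0 ≤ γ)
    (hΔ0 : 0 < Δ) (hΔ : ∀ J ∈ W, J ≠ 0 → d 0 + Δ ≤ d J) (hd0 : 0 ≤ d 0) (hΛ : 0 < Λ)
    (hgt : |gt| ≤ gT) (hV : ‖x 0‖ ≤ V) (hV0 : 0 ≤ V)
    (hx : ∀ K, K ∉ W → x K = 0)
    (hFv : ∀ J, Fv J = -(Λ : ℂ) * ((d J : ℂ) * x J) -
      (gt : ℂ) * (Λ : ℂ) * ((s (J - 1) : ℂ) * x (J - 1) - (s J : ℂ) * x (J + 1))) :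
    ∑ J ∈ W.erase 0, 2 * (Fv J * conj (x J)).re ≤
      -(Λ * Δ) * ∑ J ∈ W.erase 0, ‖x J‖ ^ 2 + Λ * gT ^ 2 * γ ^ 2 * V ^ 2 / Δ := by
  classical
  have _ := hs
  have h1W' : (1 : ℤ) ∈ W.erase 0 := Finset.mem_erase.2 ⟨by norm_num, h1⟩
  have hm1W' : (-1 : ℤ) ∈ W.erase 0 := Finset.mem_erase.2 ⟨by norm_num, hm1⟩
  have hgT0 : 0 ≤ gT := (abs_nonneg _).trans hgt
  -- the fast part `R` of the state (slow entry removed)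
  set R : ℤ → ℂ := fun J => if J = 0 then 0 else x J with hR
  have hR0 : ∀ K, K ∉ W.erase 0 → R K = 0 := by
    intro K hK
    by_cases hK0 : K = 0
    · simp [hR, hK0]
    · have : K ∉ W := fun h => hK (Finset.mem_erase.2 ⟨hK0, h⟩)
      simp [hR, hK0, hx K this]
  have hRJ : ∀ J ∈ W.erase 0, R J = x J := fun J hJ => by
    simp [hR, (Finset.mem_erase.1 hJ).1]
  -- the exchange identity on `W ∖ 0`
  have hex := re_sum_conj_mul_link_eq_zero (W.erase 0) s R hR0
  -- the summand, rewritten: diagonal + exchange among fast modes + the two boundary links to `x₀`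
  set Z : ℝ := ∑ J ∈ W.erase 0, ‖x J‖ ^ 2 with hZ
  have hZ0 : 0 ≤ Z := Finset.sum_nonneg fun J _ => by positivity
  have hterm : ∀ J ∈ W.erase 0, 2 * (Fv J * conj (x J)).re =
      -2 * Λ * d J * ‖x J‖ ^ 2 -
        2 * gt * Λ * (conj (R J) * (((s (J - 1) : ℝ) : ℂ) * R (J - 1) - ((s J : ℝ) : ℂ) * R (J + 1))).re -
        2 * gt * Λ * ((if J = 1 then (((s 0 : ℝ) : ℂ) * x 0 * conj (x 1)).re else 0) -
          (if J = -1 then (((s (-1) : ℝ) : ℂ) * x 0 * conj (x (-1))).re else 0)) := by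
    intro J hJ
    have hJ0 : J ≠ 0 := (Finset.mem_erase.1 hJ).1
    rw [hFv J]
    have eRJ : R J = x J := hRJ J hJ
    -- neighbours: `x_{J∓1} = R_{J∓1}` unless the neighbour is the slow index
    by_cases hJ1 : J = 1
    · subst hJ1
      have em : R (1 - 1) = 0 := by simp [hR]
      have ep : R (1 + 1) = x (1 + 1) := by simp [hR]
      simp only [if_true, show (1:ℤ) ≠ -1 by norm_num, if_false, sub_zero]
      rw [eRJ, em, ep]
      have e1 : (-(Λ : ℂ) * ((d 1 : ℂ) * x 1) -
          (gt : ℂ) * (Λ : ℂ) * ((s (1 - 1) : ℂ) * x (1 - 1) - (s 1 : ℂ) * x (1 + 1))) * conj (x 1) =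
          -(((Λ * d 1 : ℝ) : ℂ) * (x 1 * conj (x 1))) -
            ((gt * Λ : ℝ) : ℂ) * (conj (x 1) * (((s (1 - 1) : ℝ) : ℂ) * 0 - ((s 1 : ℝ) : ℂ) * x (1 + 1))) -
            ((gt * Λ : ℝ) : ℂ) * ((s 0 : ℂ) * x 0 * conj (x 1)) := by
        simp only [sub_self]; push_cast; ring
      rw [e1, Complex.sub_re, Complex.sub_re, Complex.neg_re, Complex.mul_conj', ← Complex.ofReal_pow,
        ← Complex.ofReal_mul, Complex.ofReal_re, Complex.re_ofReal_mul, Complex.re_ofReal_mul]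
      ring
    · by_cases hJm1 : J = -1
      · subst hJm1
        have em : R (-1 - 1) = x (-1 - 1) := by simp [hR]
        have ep : R (-1 + 1) = 0 := by simp [hR]
        simp only [if_true, show (-1:ℤ) ≠ 1 by norm_num, if_false, zero_sub]
        rw [eRJ, em, ep]
        have e1 : (-(Λ : ℂ) * ((d (-1) : ℂ) * x (-1)) -
            (gt : ℂ) * (Λ : ℂ) * ((s (-1 - 1) : ℂ) * x (-1 - 1) - (s (-1) : ℂ) * x (-1 + 1))) * conj (x (-1)) =
            -(((Λ * d (-1) : ℝ) : ℂ) * (x (-1) * conj (x (-1)))) -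
              ((gt * Λ : ℝ) : ℂ) * (conj (x (-1)) * (((s (-1 - 1) : ℝ) : ℂ) * x (-1 - 1) - ((s (-1) : ℝ) : ℂ) * 0)) +
              ((gt * Λ : ℝ) : ℂ) * ((s (-1) : ℂ) * x 0 * conj (x (-1))) := by
          simp only [neg_add_cancel]; push_cast; ring
        rw [e1, Complex.add_re, Complex.sub_re, Complex.neg_re, Complex.mul_conj', ← Complex.ofReal_pow,
          ← Complex.ofReal_mul, Complex.ofReal_re, Complex.re_ofReal_mul, Complex.re_ofReal_mul]
        ring
      · have em : R (J - 1) = x (J - 1) := by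
          have : J - 1 ≠ 0 := fun h => hJ1 (by omega)
          simp [hR, this]
        have ep : R (J + 1) = x (J + 1) := by
          have : J + 1 ≠ 0 := fun h => hJm1 (by omega)
          simp [hR, this]
        simp only [hJ1, hJm1, if_false, sub_zero]
        rw [eRJ, em, ep]
        have e1 : (-(Λ : ℂ) * ((d J : ℂ) * x J) -
            (gt : ℂ) * (Λ : ℂ) * ((s (J - 1) : ℂ) * x (J - 1) - (s J : ℂ) * x (J + 1))) * conj (x J) =
            -(((Λ * d J : ℝ) : ℂ) * (x J * conj (x J))) -
              ((gt * Λ : ℝ) : ℂ) * (conj (x J) * (((s (J - 1) : ℝ) : ℂ) * x (J - 1) - ((s J : ℝ) : ℂ) * x (J + 1))) := by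
          push_cast; ring
        rw [e1, Complex.sub_re, Complex.neg_re, Complex.mul_conj', ← Complex.ofReal_pow,
          ← Complex.ofReal_mul, Complex.ofReal_re, Complex.re_ofReal_mul]
        ring
  have hex' : ∑ J ∈ W.erase 0, (conj (R J) * (((s (J - 1) : ℝ) : ℂ) * R (J - 1) - ((s J : ℝ) : ℂ) * R (J + 1))).re = 0 := by
    rw [← Complex.re_sum]; exact hex
  rw [Finset.sum_congr rfl hterm, Finset.sum_sub_distrib, Finset.sum_sub_distrib, ← Finset.mul_sum, ← Finset.mul_sum,
    hex', mul_zero, sub_zero, Finset.sum_sub_distrib, Finset.sum_ite_eq' (W.erase 0) (1 : ℤ),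
    Finset.sum_ite_eq' (W.erase 0) (-1 : ℤ), if_pos h1W', if_pos hm1W']
  -- the diagonal: `d_J ≥ d₀ + Δ ≥ Δ`
  have hdiag : ∑ J ∈ W.erase 0, -2 * Λ * d J * ‖x J‖ ^ 2 ≤ -2 * Λ * Δ * Z := by
    rw [hZ, Finset.mul_sum]
    refine Finset.sum_le_sum fun J hJ => ?_
    have hJ' := Finset.mem_erase.1 hJ
    have hdJ : Δ ≤ d J := by linarith [hΔ J hJ'.2 hJ'.1]
    have : 0 ≤ Λ * ‖x J‖ ^ 2 := by positivity
    nlinarith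
  -- the two boundary links: Cauchy–Schwarz
  have hb : |(((s 0 : ℝ) : ℂ) * x 0 * conj (x 1)).re - (((s (-1) : ℝ) : ℂ) * x 0 * conj (x (-1))).re| ≤
      V * (γ * Real.sqrt Z) := by
    have e : (((s 0 : ℝ) : ℂ) * x 0 * conj (x 1)).re - (((s (-1) : ℝ) : ℂ) * x 0 * conj (x (-1))).re =
        (x 0 * (((s 0 : ℝ) : ℂ) * conj (x 1) - ((s (-1) : ℝ) : ℂ) * conj (x (-1)))).re := by
      rw [← Complex.sub_re]; ring_nf
    rw [e]
    refine (Complex.abs_re_le_norm _).trans ?_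
    rw [norm_mul]
    refine mul_le_mul hV ?_ (norm_nonneg _) hV0
    have h := norm_sub_two_le_sqrt (s 0) (s (-1)) (conj (x 1)) (conj (x (-1)))
    rw [Complex.norm_conj, Complex.norm_conj] at h
    have eγ : Real.sqrt (s 0 ^ 2 + s (-1) ^ 2) = γ := by rw [← hγ, Real.sqrt_sq hγ0]
    rw [eγ] at h
    refine h.trans (mul_le_mul_of_nonneg_left (Real.sqrt_le_sqrt ?_) hγ0)
    rw [hZ]
    have hsub : ({1, -1} : Finset ℤ) ⊆ W.erase 0 := by
      intro J hJ
      simp only [Finset.mem_insert, Finset.mem_singleton] at hJ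
      rcases hJ with rfl | rfl
      · exact h1W'
      · exact hm1W'
    have := Finset.sum_le_sum_of_subset_of_nonneg hsub (fun J _ _ => sq_nonneg ‖x J‖)
    rw [Finset.sum_pair (by norm_num)] at this
    exact this
  have hb' : -(2 * gt * Λ * ((((s 0 : ℝ) : ℂ) * x 0 * conj (x 1)).re - (((s (-1) : ℝ) : ℂ) * x 0 * conj (x (-1))).re)) ≤
      2 * gT * Λ * (V * (γ * Real.sqrt Z)) := by
    have h2 : |2 * gt * Λ * ((((s 0 : ℝ) : ℂ) * x 0 * conj (x 1)).re -
        (((s (-1) : ℝ) : ℂ) * x 0 * conj (x (-1))).re)| ≤ 2 * gT * Λ * (V * (γ * Real.sqrt Z)) := by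
      rw [abs_mul, abs_mul, abs_mul, abs_of_pos hΛ, abs_two]
      exact mul_le_mul (mul_le_mul_of_nonneg_right (mul_le_mul_of_nonneg_left hgt zero_le_two) hΛ.le) hb
        (abs_nonneg _) (by positivity)
    exact (neg_le_abs _).trans h2
  -- AM–GM: `2ΛgTVγ√Z ≤ ΛΔZ + ΛgT²γ²V²/Δ`
  have hAG : 2 * (gT * Λ * (V * (γ * Real.sqrt Z))) ≤ Λ * Δ * Z + Λ * gT ^ 2 * γ ^ 2 * V ^ 2 / Δ := by
    have hsq : Real.sqrt Z ^ 2 = Z := Real.sq_sqrt hZ0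
    refine two_mul_le_add_of_sq_le_mul (by positivity) (by positivity) (le_of_eq ?_)
    have e : (gT * Λ * (V * (γ * Real.sqrt Z))) ^ 2 = gT ^ 2 * Λ ^ 2 * V ^ 2 * γ ^ 2 * Real.sqrt Z ^ 2 := by ring
    rw [e, hsq]
    field_simp
  linarith [hdiag, hb', hAG]

/-- **First-order cone of the fast components on a window.** For the three-term ladder on a window `[t₀, t₁]`
(`W ∋ 0, ±1`, links `|s_J| ≤ 1`, gap `d_J ≥ d₀ + Δ` off `0`, `d₀ ≥ 0`, `|g| ≤ g_T`) whose slow entry is bounded on the window,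
`‖v₀(t)‖ ≤ V`, the fast energy relaxes to the first-order slaving cone:
`Σ_{J≠0}‖v_J(t)‖² ≤ e^{−ΛΔ(t−t₀)}·Σ_{J≠0}‖v_J(t₀)‖² + (g_T γ V/Δ)²` for every `t ∈ [t₀, t₁]`. -/
theorem fast_energy_window (W : Finset ℤ) (h1 : (1 : ℤ) ∈ W) (hm1 : (-1 : ℤ) ∈ W)
    (d s : ℤ → ℝ) (Λ gT Δ γ V t₀ t₁ : ℝ) (g : ℝ → ℝ) (v : ℝ → ℤ → ℂ)
    (hs : ∀ J ∈ W, |s J| ≤ 1) (hγ : γ ^ 2 = s 0 ^ 2 + s (-1) ^ 2) (hγ0 : 0 ≤ γ)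
    (hΔ0 : 0 < Δ) (hΔ : ∀ J ∈ W, J ≠ 0 → d 0 + Δ ≤ d J) (hd0 : 0 ≤ d 0) (hΛ : 0 < Λ)
    (hgT : ∀ t ∈ Icc t₀ t₁, |g t| ≤ gT) (hV : ∀ t ∈ Icc t₀ t₁, ‖v t 0‖ ≤ V) (hV0 : 0 ≤ V)
    (hsupp : ∀ t ∈ Icc t₀ t₁, ∀ J, J ∉ W → v t J = 0)
    (hderiv : ∀ t ∈ Icc t₀ t₁, ∀ J ∈ W, HasDerivWithinAt (fun τ => v τ J)
        (-(Λ : ℂ) * ((d J : ℂ) * v t J) -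
          (g t : ℂ) * (Λ : ℂ) * ((s (J - 1) : ℂ) * v t (J - 1) - (s J : ℂ) * v t (J + 1))) (Icc t₀ t₁) t) :
    ∀ t ∈ Icc t₀ t₁, ∑ J ∈ W.erase 0, ‖v t J‖ ^ 2 ≤
      Real.exp (-(Λ * Δ) * (t - t₀)) * ∑ J ∈ W.erase 0, ‖v t₀ J‖ ^ 2 + (gT * γ * V / Δ) ^ 2 := by
  classical
  obtain ⟨Fv, hFv⟩ : ∃ Fv : ℝ → ℤ → ℂ, Fv = fun τ J => -(Λ : ℂ) * ((d J : ℂ) * v τ J) -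
      (g τ : ℂ) * (Λ : ℂ) * ((s (J - 1) : ℂ) * v τ (J - 1) - (s J : ℂ) * v τ (J + 1)) := ⟨_, rfl⟩
  obtain ⟨Z, hZ⟩ : ∃ Z : ℝ → ℝ, Z = fun τ => ∑ J ∈ W.erase 0, ‖v τ J‖ ^ 2 := ⟨_, rfl⟩
  obtain ⟨D, hD⟩ : ∃ D : ℝ → ℝ, D = fun τ => ∑ J ∈ W.erase 0, 2 * (Fv τ J * conj (v τ J)).re := ⟨_, rfl⟩
  obtain ⟨C, hC⟩ : ∃ C : ℝ, C = gT ^ 2 * γ ^ 2 * V ^ 2 / Δ ^ 2 := ⟨_, rfl⟩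
  -- Step 1: `Z' = D`
  have hZderiv : ∀ τ ∈ Icc t₀ t₁, HasDerivWithinAt Z (D τ) (Icc t₀ t₁) τ := by
    intro τ hτ
    have hrJ : ∀ J ∈ W.erase 0, HasDerivWithinAt (fun τ' => ‖v τ' J‖ ^ 2) (2 * (Fv τ J * conj (v τ J)).re)
        (Icc t₀ t₁) τ := by
      intro J hJ
      have h := (hderiv τ hτ J (Finset.mem_of_mem_erase hJ)).norm_sq
      simp only [Complex.inner] at h
      rw [hFv]; exact h
    rw [hZ, hD]
    exact HasDerivWithinAt.fun_sum hrJ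
  -- Step 2: `D ≤ −ΛΔ Z + ΛΔ C`
  have hpoint : ∀ τ ∈ Icc t₀ t₁, D τ ≤ -(Λ * Δ) * Z τ + Λ * gT ^ 2 * γ ^ 2 * V ^ 2 / Δ := by
    intro τ hτ
    have h := fast_energy_pointwise W h1 hm1 d s Λ gT Δ γ V (g τ) (v τ) (Fv τ) hs hγ hγ0 hΔ0 hΔ hd0 hΛ (hgT τ hτ)
      (hV τ hτ) hV0 (hsupp τ hτ) (fun J => by rw [hFv])
    rw [hD, hZ]; exact h
  -- Step 3: `exp(ΛΔ(τ−t₀))·(Z − C)` is non-increasing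
  have hGderiv : ∀ τ ∈ Icc t₀ t₁, HasDerivWithinAt (fun τ' => Real.exp (Λ * Δ * (τ' - t₀)) * (Z τ' - C))
      (Real.exp (Λ * Δ * (τ - t₀)) * (Λ * Δ) * (Z τ - C) + Real.exp (Λ * Δ * (τ - t₀)) * D τ) (Icc t₀ t₁) τ := by
    intro τ hτ
    have h1 : HasDerivWithinAt (fun τ' => Λ * Δ * (τ' - t₀)) (Λ * Δ) (Icc t₀ t₁) τ := by
      simpa using ((hasDerivWithinAt_id τ (Icc t₀ t₁)).sub_const t₀).const_mul (Λ * Δ)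
    have h2 := (h1.exp).mul ((hZderiv τ hτ).sub_const C)
    refine h2.congr_deriv ?_
    ring
  have hGanti : AntitoneOn (fun τ' => Real.exp (Λ * Δ * (τ' - t₀)) * (Z τ' - C)) (Icc t₀ t₁) := by
    refine antitoneOn_of_hasDerivWithinAt_nonpos (convex_Icc t₀ t₁)
      (f' := fun τ => Real.exp (Λ * Δ * (τ - t₀)) * (Λ * Δ) * (Z τ - C) + Real.exp (Λ * Δ * (τ - t₀)) * D τ)
      (fun τ hτ => (hGderiv τ hτ).continuousWithinAt) (fun τ hτ => ?_) (fun τ hτ => ?_)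
    · rw [interior_Icc] at hτ
      exact ((hGderiv τ (Ioo_subset_Icc_self hτ)).mono (interior_subset)).mono_of_mem_nhdsWithin
        (by rw [interior_Icc]; exact self_mem_nhdsWithin)
    · rw [interior_Icc] at hτ
      have hτ' := Ioo_subset_Icc_self hτ
      have e : Real.exp (Λ * Δ * (τ - t₀)) * (Λ * Δ) * (Z τ - C) + Real.exp (Λ * Δ * (τ - t₀)) * D τ =
          Real.exp (Λ * Δ * (τ - t₀)) * (D τ + Λ * Δ * (Z τ - C)) := by ring
      rw [e]
      refine mul_nonpos_of_nonneg_of_nonpos (Real.exp_pos _).le ?_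
      have hCe : Λ * Δ * C = Λ * gT ^ 2 * γ ^ 2 * V ^ 2 / Δ := by rw [hC]; field_simp
      linarith [hpoint τ hτ', hCe]
  -- conclusion
  intro t ht
  have ht₀ : t₀ ∈ Icc t₀ t₁ := ⟨le_rfl, ht.1.trans ht.2⟩
  have hmono := hGanti ht₀ ht ht.1
  simp only [sub_self, mul_zero, Real.exp_zero, one_mul] at hmono
  have hC0 : 0 ≤ C := by rw [hC]; positivity
  have hexp := Real.exp_pos (-(Λ * Δ) * (t - t₀))
  have h2 : Z t - C ≤ Real.exp (-(Λ * Δ) * (t - t₀)) * (Z t₀ - C) := by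
    have := mul_le_mul_of_nonneg_left hmono hexp.le
    rwa [← mul_assoc, ← Real.exp_add, show -(Λ * Δ) * (t - t₀) + Λ * Δ * (t - t₀) = 0 by ring, Real.exp_zero,
      one_mul] at this
  have h3 : Real.exp (-(Λ * Δ) * (t - t₀)) * (Z t₀ - C) ≤ Real.exp (-(Λ * Δ) * (t - t₀)) * Z t₀ := by
    nlinarith [hexp, hC0]
  have eC : (gT * γ * V / Δ) ^ 2 = C := by rw [hC]; ring
  rw [eC]
  have : Z t ≤ Real.exp (-(Λ * Δ) * (t - t₀)) * Z t₀ + C := by linarith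
  simpa only [hZ] using this

/-! ## §2 Two small facts about the slot data -/

/-- The trapezoid coupling is bounded by its plateau value: `|g₁ · trapezoid 0 τ ρ x| ≤ |g₁|`. -/
theorem abs_mul_trapezoid_le (g₁ τ ρ x : ℝ) : |g₁ * LatticeWord.trapezoid 0 τ ρ x| ≤ |g₁| := by
  have h01 : 0 ≤ LatticeWord.trapezoid 0 τ ρ x ∧ LatticeWord.trapezoid 0 τ ρ x ≤ 1 := by
    unfold LatticeWord.trapezoid
    exact ⟨le_max_left _ _, max_le zero_le_one (min_le_left _ _)⟩
  rw [abs_mul, abs_of_nonneg h01.1]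
  exact mul_le_of_le_one_right (abs_nonneg _) h01.2

/-- The ladder rate of a slot is positive: `0 < κ·4π²|K_j|²` for `κ > 0`, `n ≥ 1`. -/
theorem cellRate_pos (P : LatticePhase) {n : ℕ} (hn : 0 < n) {κ : ℝ} (hκ : 0 < κ) :
    0 < κ * (4 * Real.pi ^ 2 * freqNormSq (fun i => P.m i * (n : ℤ))) := by
  have hK0 : (fun i => P.m i * (n : ℤ)) ≠ 0 := cellFreq_ne_zero P hn
  have hKpos : 0 < freqNormSq (fun i => P.m i * (n : ℤ)) := by
    obtain ⟨i, hi⟩ : ∃ i, (fun i => P.m i * (n : ℤ)) i ≠ 0 := by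
      by_contra h
      push Not at h
      exact hK0 (funext h)
    have hi' : (((fun i => P.m i * (n : ℤ)) i : ℤ) : ℝ) ≠ 0 := by exact_mod_cast hi
    unfold freqNormSq
    exact lt_of_lt_of_le (by positivity)
      (Finset.single_le_sum (fun l _ => sq_nonneg (((fun i => P.m i * (n : ℤ)) l : ℝ))) (Finset.mem_univ i))
  positivity

end Summit.AnomalousDissipation.AnomalousDissipation.Theorems.SolenoidalFractalHomogenisation.RealisedQuasiStaticCellLaw

end
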